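import Mathlib.Algebra.MvPolynomial.Monad
import Mathlib.Data.Fintype.BigOperators
import Mathlib.Algebra.BigOperators.Group.Finset.Piecewise
import Literature.Computability.QuantumComplexity.CubicForrelation
import Literature.Computability.QuantumComplexity.IQPForrelation
import Literature.Computability.AlgebraicComplexity.PowerSumNonvanishing

/-!
# Crux `CubicForrelation.NearExactIsExact` (stmt-QuantumAdvantage-14043), line `direct-sum-amplification` —
stub R: the minimum weight of the Reed–Muller code `RM(d,m)`

In the tree's `Bool` / `IsDegLeFun` vocabulary: a Boolean function `e` on `m` bits of algebraic degree `≤ d`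
that takes the value `true` somewhere takes it on at least `2^{m−d}` points, stated division-free as
`2^m ≤ 2^d · #{x : e x = true}` (for `d ≥ m` this is just `wt(e) ≥ 1`). This is the minimum distance
`2^{m−d}` of `RM(d,m)` (Carlet 2020, Thm 7 p. 192), proved here from the single outside ingredient
"a discrete derivative `x ↦ e(x) ⊕ e(x ⊕ t)` lowers the degree by one" (stub D of the line), which enters
as a HYPOTHESIS of `stub_rmWeight`.

Proof (the classical `(u, u + v)` induction). Degree `0`: a polynomial of total degree `0` is a constant
(`MvPolynomial.totalDegree_eq_zero_iff_eq_C`), so `e` is constantly `true` and has full weight `2^m`.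
Degree `d + 1`, by induction on `m`: split off the first coordinate, `e_b := e(b, ·)` (`Fin.cons`); both
restrictions have degree `≤ d + 1` (substitute `X₀ ↦ b`, `X_{j+1} ↦ X_j`, all of degree `≤ 1`, and use
`totalDegree_aeval_le_of_forall_le_one`), and `wt(e) = wt(e₀) + wt(e₁)` (`rm_card_split`). If `e₀ = e₁`
both carry the witness and `wt(e) = 2·wt(e₀) ≥ 2·2^{m−d−1}`. Otherwise `e₀ ⊕ e₁ ≠ 0` is the derivative of
`e` in direction `(1, 0, …, 0)` restricted to `x₀ = 0`, of degree `≤ d` by the hypothesis, so by induction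
`wt(e₀ ⊕ e₁) ≥ 2^{m−d}`, and `wt(e₀) + wt(e₁) ≥ wt(e₀ ⊕ e₁)`.

References: C. Carlet, *Boolean Functions for Cryptography and Coding Theory*, CUP 2020, §4.1 Thm 7
(minimum distance of Reed–Muller codes); F. J. MacWilliams, N. J. A. Sloane, *The Theory of
Error-Correcting Codes* (1977), Ch. 13 §3 Thm 3 (the `(u, u+v)` proof).
-/

set_option linter.dupNamespace false -- D-0017: single-problem summit ⇒ `QuantumAdvantage.QuantumAdvantage` by design

noncomputable section

namespace Summit.QuantumAdvantage.QuantumAdvantage.Theorems.CubicForrelation.NearExactIsExact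

open Finset
open Literature.Computability.QuantumComplexity
open Literature.Computability.QuantumComplexity.BuzetChailloux (bxor zeroVec signOf_sq)

/-! ### Small Boolean facts -/

/-- `a ≠ b → a ⊕ b = 1` on `Bool`. [folklore] -/
theorem rm_xor_eq_true_of_ne : ∀ a b : Bool, a ≠ b → (a ^^ b) = true := by decide

/-- `a ⊕ b = 1 → a = 1 ∨ b = 1` on `Bool`. [folklore] -/
theorem rm_or_of_xor_eq_true : ∀ a b : Bool, (a ^^ b) = true → a = true ∨ b = true := by decide

/-- `(0, y) ⊕ (1, 0, …, 0) = (1, y)`: translating by the first unit vector flips the first coordinate.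
[folklore] -/
theorem rm_bxor_cons {m : ℕ} (y : Fin m → Bool) :
    bxor (Fin.cons false y) (Fin.cons true zeroVec) = (Fin.cons true y : Fin (m + 1) → Bool) := by
  funext i
  refine Fin.cases ?_ (fun j => ?_) i
  · simp [bxor]
  · simp [bxor, zeroVec]

/-! ### Degree bookkeeping: pointwise congruence and restriction of the first coordinate -/

/-- `IsDegLeFun d` only depends on the function pointwise. [cite: Carlet2020, §2.2.1 Def. 6] -/
theorem rm_isDegLeFun_congr {n d : ℕ} {f g : (Fin n → Bool) → Bool} (hf : IsDegLeFun d f)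
    (hfg : ∀ x, f x = g x) : IsDegLeFun d g := by
  obtain ⟨p, hp, hpf⟩ := hf
  exact ⟨p, hp, fun x => (hfg x).symm.trans (hpf x)⟩

/-- Fixing the first coordinate to a constant keeps algebraic degree `≤ d`: substitute `X₀ ↦ b`,
`X_{j+1} ↦ X_j` (all of total degree `≤ 1`) into a representing polynomial.
[cite: Carlet2020, §2.2.1 Def. 6] -/
theorem rm_isDegLeFun_cons {m d : ℕ} {e : (Fin (m + 1) → Bool) → Bool} (h : IsDegLeFun d e)
    (b : Bool) : IsDegLeFun d (fun y : Fin m → Bool => e (Fin.cons b y)) := by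
  classical
  obtain ⟨p, hp, he⟩ := h
  obtain ⟨φ, hφ0, hφs⟩ : ∃ φ : Fin (m + 1) → MvPolynomial (Fin m) (ZMod 2),
      φ 0 = MvPolynomial.C (if b then 1 else 0) ∧ ∀ j : Fin m, φ j.succ = MvPolynomial.X j :=
    ⟨Fin.cons (MvPolynomial.C (if b then 1 else 0)) MvPolynomial.X, Fin.cons_zero _ _,
      fun j => Fin.cons_succ _ _ j⟩
  have hφ : ∀ i, (φ i).totalDegree ≤ 1 := by
    intro i
    refine Fin.cases ?_ (fun j => ?_) i
    · rw [hφ0, MvPolynomial.totalDegree_C]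
      exact Nat.zero_le _
    · rw [hφs, MvPolynomial.totalDegree_X]
  refine ⟨MvPolynomial.aeval φ p,
    (Literature.Computability.AlgebraicComplexity.totalDegree_aeval_le_of_forall_le_one φ hφ p).trans hp,
    fun y => ?_⟩
  -- the substituted point: `(φ i)(y) = (b, y)_i`
  have hpt : (fun i => MvPolynomial.eval (fun j => if y j then (1 : ZMod 2) else 0) (φ i)) =
      fun j => if (Fin.cons b y : Fin (m + 1) → Bool) j then (1 : ZMod 2) else 0 := by
    funext i
    refine Fin.cases ?_ (fun j => ?_) i
    · rw [hφ0, MvPolynomial.eval_C, Fin.cons_zero]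
    · rw [hφs, MvPolynomial.eval_X, Fin.cons_succ]
  have hev : MvPolynomial.eval (fun j => if y j then (1 : ZMod 2) else 0) (MvPolynomial.aeval φ p) =
      MvPolynomial.eval (fun j => if (Fin.cons b y : Fin (m + 1) → Bool) j then (1 : ZMod 2) else 0) p := by
    rw [← hpt]
    exact MvPolynomial.eval₂Hom_bind₁ _ _ _ _
  show e (Fin.cons b y) = polyPhase (MvPolynomial.aeval φ p) y
  rw [he, polyPhase_apply, polyPhase_apply, hev]

/-! ### Weights -/

/-- Splitting off the first coordinate: `wt(e) = wt(e(0,·)) + wt(e(1,·))`. [folklore] -/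
theorem rm_card_split {m : ℕ} (e : (Fin (m + 1) → Bool) → Bool) :
    (univ.filter fun x => e x = true).card =
      (univ.filter fun y : Fin m → Bool => e (Fin.cons false y) = true).card +
        (univ.filter fun y : Fin m → Bool => e (Fin.cons true y) = true).card := by
  have h1 : ∑ x : Fin (m + 1) → Bool, (if e x = true then 1 else 0) =
      ∑ q : Bool × (Fin m → Bool), (if e (Fin.cons q.1 q.2) = true then 1 else 0) :=
    (Fintype.sum_equiv (Fin.consEquiv fun _ => Bool)
      (fun q => if e (Fin.cons q.1 q.2) = true then 1 else 0)
      (fun x => if e x = true then 1 else 0) (fun _ => rfl)).symm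
  rw [Finset.card_filter, Finset.card_filter, Finset.card_filter, h1, Fintype.sum_prod_type,
    Fintype.sum_bool, Nat.add_comm]

/-- A function with a `true` point has weight `≥ 1`. [folklore] -/
theorem rm_one_le_card {m : ℕ} {e : (Fin m → Bool) → Bool} (hx : ∃ x, e x = true) :
    1 ≤ (univ.filter fun x => e x = true).card := by
  obtain ⟨x, hx⟩ := hx
  exact Finset.card_pos.mpr ⟨x, Finset.mem_filter.mpr ⟨Finset.mem_univ _, hx⟩⟩

/-- Degree `0`: a function of algebraic degree `≤ 0` with a `true` point is constantly `true`, so it has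
full weight `2^m` (`totalDegree p = 0 ⇒ p = C _`). [cite: Carlet2020, §4.1 Thm 7] -/
theorem rm_card_of_deg_zero {m : ℕ} {e : (Fin m → Bool) → Bool} (h : IsDegLeFun 0 e)
    (hx : ∃ x, e x = true) : (univ.filter fun x => e x = true).card = 2 ^ m := by
  obtain ⟨p, hp, he⟩ := h
  obtain ⟨x₀, hx₀⟩ := hx
  have hpC : p = MvPolynomial.C (p.coeff 0) :=
    MvPolynomial.totalDegree_eq_zero_iff_eq_C.mp (Nat.le_zero.mp hp)
  have hconst : ∀ x, e x = true := by
    intro x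
    rw [← hx₀, he, he, hpC, polyPhase_C, polyPhase_C]
  rw [Finset.filter_true_of_mem (fun x _ => hconst x), Finset.card_univ, Fintype.card_fun,
    Fintype.card_bool, Fintype.card_fin]

/-- The inductive step on two slices `e₀ = e(0,·)`, `e₁ = e(1,·)`: given the bound at degree `d + 1` for
each slice and at degree `d` for their xor (the restricted derivative), `2^{m+1} ≤ 2^{d+1}(wt e₀ + wt e₁)`.
[cite: Carlet2020, §4.1 Thm 7] -/
theorem rm_step {m d : ℕ} (e₀ e₁ : (Fin m → Bool) → Bool)
    (ih₀ : (∃ y, e₀ y = true) → 2 ^ m ≤ 2 ^ (d + 1) * (univ.filter fun y => e₀ y = true).card)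
    (ihΔ : (∃ y, (e₀ y ^^ e₁ y) = true) →
      2 ^ m ≤ 2 ^ d * (univ.filter fun y => (e₀ y ^^ e₁ y) = true).card)
    (hx : (∃ y, e₀ y = true) ∨ (∃ y, e₁ y = true)) :
    2 ^ (m + 1) ≤ 2 ^ (d + 1) *
      ((univ.filter fun y => e₀ y = true).card + (univ.filter fun y => e₁ y = true).card) := by
  by_cases heq : e₀ = e₁
  · subst heq
    have h := ih₀ (hx.elim id id)
    rw [pow_succ 2 m, Nat.mul_add]
    omega
  · obtain ⟨y, hy⟩ : ∃ y, e₀ y ≠ e₁ y := Function.ne_iff.mp heq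
    have hΔ := ihΔ ⟨y, rm_xor_eq_true_of_ne _ _ hy⟩
    have hsub : (univ.filter fun y => (e₀ y ^^ e₁ y) = true) ⊆
        (univ.filter fun y => e₀ y = true) ∪ (univ.filter fun y => e₁ y = true) := by
      intro z
      simp only [Finset.mem_filter, Finset.mem_union, Finset.mem_univ, true_and]
      exact rm_or_of_xor_eq_true _ _
    have hle := (Finset.card_le_card hsub).trans (Finset.card_union_le _ _)
    set wΔ := (univ.filter fun y => (e₀ y ^^ e₁ y) = true).card
    set w₀ := (univ.filter fun y => e₀ y = true).card
    set w₁ := (univ.filter fun y => e₁ y = true).card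
    calc 2 ^ (m + 1) = 2 * 2 ^ m := by rw [pow_succ, mul_comm]
      _ ≤ 2 * (2 ^ d * wΔ) := Nat.mul_le_mul_left 2 hΔ
      _ ≤ 2 * (2 ^ d * (w₀ + w₁)) := Nat.mul_le_mul_left 2 (Nat.mul_le_mul_left _ hle)
      _ = 2 ^ (d + 1) * (w₀ + w₁) := by rw [pow_succ]; ring

/-- The main induction (on the number of bits `m`, for all degrees `d` at once): from the
derivative-lowers-degree hypothesis, `2^m ≤ 2^d · wt(e)` for every nonzero `e` of degree `≤ d`.
[cite: Carlet2020, §4.1 Thm 7] -/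
theorem rm_main
    (hD : ∀ (n d : ℕ) (e : (Fin n → Bool) → Bool) (t : Fin n → Bool), IsDegLeFun (d + 1) e →
      IsDegLeFun d (fun x => e x ^^ e (bxor x t))) :
    ∀ (m d : ℕ) (e : (Fin m → Bool) → Bool), IsDegLeFun d e → (∃ x, e x = true) →
      2 ^ m ≤ 2 ^ d * (univ.filter fun x => e x = true).card := by
  intro m
  induction m with
  | zero =>
    intro d e _ hx
    calc 2 ^ 0 = 1 * 1 := by norm_num
      _ ≤ 2 ^ d * (univ.filter fun x => e x = true).card :=
        Nat.mul_le_mul Nat.one_le_two_pow (rm_one_le_card hx)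
  | succ m ih =>
    intro d e hd hx
    cases d with
    | zero =>
      rw [rm_card_of_deg_zero hd hx, pow_zero, one_mul]
    | succ d =>
      rw [rm_card_split e]
      refine rm_step (fun y => e (Fin.cons false y)) (fun y => e (Fin.cons true y))
        (ih (d + 1) _ (rm_isDegLeFun_cons hd false)) (ih d _ ?_) ?_
      · -- the xor of the two slices is the derivative in direction `(1, 0, …, 0)` restricted to `x₀ = 0`
        refine rm_isDegLeFun_congr
          (rm_isDegLeFun_cons (hD (m + 1) d e (Fin.cons true zeroVec) hd) false) (fun y => ?_)
        show (e (Fin.cons false y) ^^ e (bxor (Fin.cons false y) (Fin.cons true zeroVec))) = _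
        rw [rm_bxor_cons]
      · -- the witness lies in one of the two slices
        obtain ⟨x, hx⟩ := hx
        have key : ∀ b : Bool, e (Fin.cons b (Fin.tail x)) = true →
            (∃ y, e (Fin.cons false y) = true) ∨ (∃ y, e (Fin.cons true y) = true) := by
          rintro (_ | _) h
          · exact Or.inl ⟨_, h⟩
          · exact Or.inr ⟨_, h⟩
        exact key (x 0) (by rwa [Fin.cons_self_tail])

/-- **stub_rmWeight** (R; minimum distance of the Reed–Muller code `RM(d,m)`, Carlet 2020 Thm 7, in the
tree's `Bool`/`IsDegLeFun` vocabulary, division-free): GIVEN that discrete derivatives lower the algebraic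
degree by one (stub D of the line), a function of degree `≤ d` on `m` bits that takes the value `true`
somewhere takes it on at least `2^{m−d}` points: `2^m ≤ 2^d · #{x : e x = true}`.
[cite: Carlet2020, §4.1 Thm 7] -/
theorem stub_rmWeight :
    (∀ (n d : ℕ) (e : (Fin n → Bool) → Bool) (t : Fin n → Bool), IsDegLeFun (d + 1) e →
      IsDegLeFun d (fun x => e x ^^ e (bxor x t))) →
    ∀ (m d : ℕ) (e : (Fin m → Bool) → Bool), IsDegLeFun d e → (∃ x, e x = true) →
      2 ^ m ≤ 2 ^ d * (univ.filter fun x => e x = true).card :=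
  rm_main

end Summit.QuantumAdvantage.QuantumAdvantage.Theorems.CubicForrelation.NearExactIsExact
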